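import Literature.Geometry.Kaehler.ManifoldFormsChart
import Literature.Geometry.Manifold.OpenSubmanifoldMFDeriv
import Literature.NumberTheory.Transcendental.FormsAlgebra
import HarnessLib

/-!
# Differential forms on manifolds: the chart calculus of the pull-back (naturality of `d`)

Layer `Literature/Geometry/Kaehler`, companion to `ManifoldFormsChart` (chart calculus of `d`).
For a map of manifolds `f : M → N` (models with corners `I` on `E`, `I'` on `E'`, any real normed
coefficient space `F`) and a `k`-form `β` on `N`, the pull-back `f^*β = β.pullback I f` of
`Literature/NumberTheory/Transcendental/FormsAlgebra` is computed in charts, and the two NAMED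
FACTS of that file about it are PROVED:

* `MForm.inChart_pullback_eq` / `MForm.inChart_pullback_eventuallyEq` — in the preferred charts at
  `x` and `f x`, the representative of `f^*β` is the normed-space pull-back of the representative
  of `β` along the written map `g = extChartAt I' (f x) ∘ f ∘ (extChartAt I x).symm`:
  `(f^*β).inChart x y = (β.inChart (f x) (g y)) ∘ (fderivWithin ℝ g (range I) y)` near the centre
  (chain rule for `mfderiv` in charts);
* `MForm.SmoothAt.pullback` — if `f` is `C^∞` near `x` and `β` is smooth at `f x`, then `f^*β` is
  smooth at `x` (Warner 2.22);
* `mextDeriv_pullback_apply` — under the same hypotheses `d(f^*β) x = f^*(dβ) x`, the manifold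
  form of Mathlib's `extDerivWithin_pullback` (Warner, Prop. 2.23), POINTWISE, so that it applies
  to forms smooth only on an open set;
* `isSmoothFormPullback_holds`, `mextDerivPullback_holds` — discharge of the named facts
  `IsSmoothFormPullback I M I' N F` and `MextDerivPullback I M I' N F` of `FormsAlgebra`, for
  every pair of `C^∞` manifolds (any models with corners) and every `F`; whence the GLOBAL
  instance `instPullbackFacts : PullbackFacts I M I' N F`, which makes every hypothesis schema
  `[PullbackFacts …]` / `hPB` of the tree (de Rham functoriality `deRhamCohomology.map`,
  `complexDeRhamCohomology.map`, naturality of Hodge-model comparisons) unconditional;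
* the inclusion of an open submanifold `U : TopologicalSpace.Opens M`: `mfderiv` of
  `Subtype.val : U → M` is the identity (`hasMFDerivAt_subtype_val`; refactor: this is the tree's
  `Literature.Topology.FourManifolds.hasMFDerivAt_subtype_val` /
  `Literature.Geometry.Lorentzian.hasMFDerivAt_subtypeVal`, restated to keep the import closure
  of the forms library free of four-manifold / Lorentzian theory), so that the restriction
  `β|_U = β.pullback I Subtype.val` is `β` read on `U` (`MForm.pullback_subtypeVal_apply`), is
  smooth where `β` is, and `d(β|_U) = (dβ)|_U` at every point of `U` near which `β` is smooth.

## References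

* F. W. Warner, *Foundations of Differentiable Manifolds and Lie Groups*, GTM 94 (1983), 2.22–2.23.
* J. M. Lee, *Introduction to Smooth Manifolds*, 2nd ed., GTM 218 (2013), Lemma 14.16,
  Prop. 14.26; Example 1.26 and Prop. 3.9 (open submanifolds).
-/

noncomputable section

open scoped Manifold ContDiff Topology
open Bundle Set Filter

namespace Literature.Geometry.Kaehler

variable {E : Type*} [NormedAddCommGroup E] [NormedSpace ℝ E]
  {H : Type*} [TopologicalSpace H] {I : ModelWithCorners ℝ E H}
  {M : Type*} [TopologicalSpace M] [ChartedSpace H M]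
  {E' : Type*} [NormedAddCommGroup E'] [NormedSpace ℝ E']
  {H' : Type*} [TopologicalSpace H'] {I' : ModelWithCorners ℝ E' H'}
  {N : Type*} [TopologicalSpace N] [ChartedSpace H' N]
  {F : Type*} [NormedAddCommGroup F] [NormedSpace ℝ F] {k : ℕ}

/-! ### The pull-back in charts -/

section Chart

variable [IsManifold I ∞ M] [IsManifold I' ∞ N]

/-- **The pull-back in charts.** Let `y` be a point of the target of the chart at `x`, with
`z = (extChartAt I x).symm y`, such that `f` is differentiable at `z` and `f z` lies in the source
of the chart at `f x`; write `g = extChartAt I' (f x) ∘ f ∘ (extChartAt I x).symm`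
(`writtenInExtChartAt`). Then the representative of `f^*β` in the chart at `x` is, at `y`, the
pull-back of the representative of `β` in the chart at `f x` along `g`:
`(f^*β).inChart x y = (β.inChart (f x) (g y)) ∘ Dg(y)`, `Dg(y) = fderivWithin ℝ g (range I) y`
(chain rule: `df_z ∘ D(extChartAt I x).symm(y) = D(extChartAt I' (f x)).symm(g y) ∘ Dg(y)`, both
being the derivative of `f ∘ (extChartAt I x).symm = (extChartAt I' (f x)).symm ∘ g` near `y`).
Warner (1983), 2.22; Lee (2013), Lemma 14.16. [cite: WarnerGTM94, 2.22] -/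
theorem MForm.inChart_pullback_eq {f : M → N} (β : MForm I' N F k) {x : M} {y : E}
    (hy : y ∈ (extChartAt I x).target)
    (hfs : f ((extChartAt I x).symm y) ∈ (extChartAt I' (f x)).source)
    (hf : MDifferentiableAt I I' f ((extChartAt I x).symm y)) :
    (β.pullback I f).inChart x y =
      (β.inChart (f x) (writtenInExtChartAt I I' x f y)).compContinuousLinearMap
        (fderivWithin ℝ (writtenInExtChartAt I I' x f) (range I) y) := by
  set z := (extChartAt I x).symm y with hz
  set g : E → E' := writtenInExtChartAt I I' x f with hg
  have hyI : y ∈ range I := extChartAt_target_subset_range x hy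
  have hU : UniqueMDiffWithinAt 𝓘(ℝ, E) (range I) y := (I.uniqueDiffOn y hyI).uniqueMDiffWithinAt
  have hgy : g y = extChartAt I' (f x) (f z) := rfl
  have hgt : g y ∈ (extChartAt I' (f x)).target := (extChartAt I' (f x)).map_source hfs
  have hfz : (extChartAt I' (f x)).symm (g y) = f z := (extChartAt I' (f x)).left_inv hfs
  have hmaps : range I ⊆ g ⁻¹' range I' := fun w _ ↦ by
    simp only [hg, writtenInExtChartAt, mem_preimage, Function.comp_apply, extChartAt_coe]
    exact mem_range_self _
  -- (1) `D(f ∘ chart⁻¹)(y) = df_z ∘ D(chart⁻¹)(y)`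
  have h1 : mfderivWithin 𝓘(ℝ, E) I' (f ∘ (extChartAt I x).symm) (range I) y =
      (mfderiv I I' f z).comp (mfderivWithin 𝓘(ℝ, E) I (extChartAt I x).symm (range I) y) :=
    mfderiv_comp_mfderivWithin y hf (mdifferentiableWithinAt_extChartAt_symm hy) hU
  -- (2) `f ∘ chart⁻¹ = chart'⁻¹ ∘ g` near `y` within `range I`
  have h2 : (f ∘ (extChartAt I x).symm) =ᶠ[𝓝[range I] y] ((extChartAt I' (f x)).symm ∘ g) := by
    have hc : ContinuousAt (f ∘ (extChartAt I x).symm) y :=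
      ContinuousAt.comp (by rw [← hz]; exact hf.continuousAt) (continuousAt_extChartAt_symm'' hy)
    have h3 : ∀ᶠ w in 𝓝 y, f ((extChartAt I x).symm w) ∈ (extChartAt I' (f x)).source :=
      hc.preimage_mem_nhds (extChartAt_source_mem_nhds' hfs)
    filter_upwards [nhdsWithin_le_nhds h3] with w hw
    simp only [Function.comp_apply, hg, writtenInExtChartAt, (extChartAt I' (f x)).left_inv hw]
  have h3 : mfderivWithin 𝓘(ℝ, E) I' (f ∘ (extChartAt I x).symm) (range I) y =
      mfderivWithin 𝓘(ℝ, E) I' ((extChartAt I' (f x)).symm ∘ g) (range I) y :=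
    h2.mfderivWithin_eq (by simp only [Function.comp_apply, hfz, hz])
  -- (3) `D(chart'⁻¹ ∘ g)(y) = D(chart'⁻¹)(g y) ∘ Dg(y)`
  have hgd : MDifferentiableWithinAt 𝓘(ℝ, E) 𝓘(ℝ, E') g (range I) y :=
    (mdifferentiableAt_extChartAt (by rw [← extChartAt_source I']; exact hfs)).comp_mdifferentiableWithinAt
      y (hf.comp_mdifferentiableWithinAt y (mdifferentiableWithinAt_extChartAt_symm hy))
  have h4 : mfderivWithin 𝓘(ℝ, E) I' ((extChartAt I' (f x)).symm ∘ g) (range I) y =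
      (mfderivWithin 𝓘(ℝ, E') I' (extChartAt I' (f x)).symm (range I') (g y)).comp
        (mfderivWithin 𝓘(ℝ, E) 𝓘(ℝ, E') g (range I) y) :=
    mfderivWithin_comp y (mdifferentiableWithinAt_extChartAt_symm hgt) hgd hmaps hU
  have h5 : mfderivWithin 𝓘(ℝ, E) 𝓘(ℝ, E') g (range I) y = fderivWithin ℝ g (range I) y :=
    mfderivWithin_eq_fderivWithin
  have key := h1.symm.trans (h3.trans h4)
  rw [h5] at key
  ext v
  simp only [MForm.inChart_apply, MForm.pullback_apply,
    ContinuousAlternatingMap.compContinuousLinearMap_apply, Function.comp_apply]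
  rw [hfz]
  congr 1
  funext i
  exact ContinuousLinearMap.ext_iff.1 key (v i)

/-- **The pull-back in charts, germ at the centre.** If `f` is differentiable near `x`, then near
the centre of the chart at `x`, within `range I`, the representative of `f^*β` is the pull-back
of the representative of `β` in the chart at `f x` along the written map
`g = writtenInExtChartAt I I' x f`. [cite: WarnerGTM94, 2.22] -/
theorem MForm.inChart_pullback_eventuallyEq {f : M → N} (β : MForm I' N F k) {x : M}
    (hf : ∀ᶠ z in 𝓝 x, MDifferentiableAt I I' f z) :
    (β.pullback I f).inChart x =ᶠ[𝓝[range I] (extChartAt I x x)]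
      fun y ↦ (β.inChart (f x) (writtenInExtChartAt I I' x f y)).compContinuousLinearMap
        (fderivWithin ℝ (writtenInExtChartAt I I' x f) (range I) y) := by
  have hfx : MDifferentiableAt I I' f x := hf.self_of_nhds
  have hfc : ContinuousAt f x := hfx.continuousAt
  have hP : ∀ᶠ z in 𝓝 x, MDifferentiableAt I I' f z ∧ f z ∈ (extChartAt I' (f x)).source :=
    hf.and (hfc.preimage_mem_nhds (extChartAt_source_mem_nhds (f x)))
  have hP'' : ∀ᶠ z in 𝓝 ((extChartAt I x).symm (extChartAt I x x)),
      MDifferentiableAt I I' f z ∧ f z ∈ (extChartAt I' (f x)).source := by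
    rwa [extChartAt_to_inv]
  have hP' : ∀ᶠ y in 𝓝 (extChartAt I x x), MDifferentiableAt I I' f ((extChartAt I x).symm y) ∧
      f ((extChartAt I x).symm y) ∈ (extChartAt I' (f x)).source :=
    (continuousAt_extChartAt_symm (I := I) x).eventually hP''
  filter_upwards [extChartAt_target_mem_nhdsWithin x, nhdsWithin_le_nhds hP'] with y hy ⟨hfd, hfs⟩
  exact β.inChart_pullback_eq hy hfs hfd

omit [IsManifold I ∞ M] [IsManifold I' ∞ N] in
/-- The written map `writtenInExtChartAt I I' x f` sends the centre of the chart at `x` to the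
centre of the chart at `f x`. [folklore] -/
theorem writtenInExtChartAt_apply_self (f : M → N) (x : M) :
    writtenInExtChartAt I I' x f (extChartAt I x x) = extChartAt I' (f x) (f x) := by
  simp only [writtenInExtChartAt, Function.comp_apply, extChartAt_to_inv]

omit [IsManifold I ∞ M] [IsManifold I' ∞ N] in
/-- The written map `writtenInExtChartAt I I' x f` takes values in `range I'`. [folklore] -/
theorem mapsTo_writtenInExtChartAt_range (f : M → N) (x : M) :
    MapsTo (writtenInExtChartAt I I' x f) (range I) (range I') := fun w _ ↦ by
  simp only [writtenInExtChartAt, Function.comp_apply, extChartAt_coe]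
  exact mem_range_self _

/-- **The pull-back of a smooth form is smooth** (Warner (1983), 2.22), pointwise: if `f` is `C^∞`
near `x` and `β` is smooth at `f x`, then `f^*β` is smooth at `x`. In the chart at `x`, `f^*β` is
the pull-back of the `C^∞` germ `β.inChart (f x)` along the `C^∞` written map `g`, a `C^∞`
expression in `(β.inChart (f x) ∘ g, Dg)`. [cite: WarnerGTM94, 2.22] -/
theorem MForm.SmoothAt.pullback {f : M → N} {β : MForm I' N F k} {x : M}
    (hf : ∀ᶠ z in 𝓝 x, ContMDiffAt I I' ∞ f z) (hβ : β.SmoothAt (f x)) :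
    (β.pullback I f).SmoothAt x := by
  have hfx : ContMDiffAt I I' ∞ f x := hf.self_of_nhds
  have hc : extChartAt I x x ∈ range I := mem_range_self _
  have hg : ContDiffWithinAt ℝ ∞ (writtenInExtChartAt I I' x f) (range I) (extChartAt I x x) :=
    (contMDiffAt_iff.1 hfx).2
  have hev := β.inChart_pullback_eventuallyEq (I := I) (I' := I')
    (hf.mono fun z hz ↦ hz.mdifferentiableAt (by simp))
  have hsm : ContDiffWithinAt ℝ ∞
      (fun y ↦ (β.inChart (f x) (writtenInExtChartAt I I' x f y)).compContinuousLinearMap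
        (fderivWithin ℝ (writtenInExtChartAt I I' x f) (range I) y)) (range I) (extChartAt I x x) := by
    refine
      Literature.NumberTheory.Transcendental.ContDiffWithinAt.continuousAlternatingMapCompContinuousLinearMap
      ?_ ?_
    · have hβ' : ContDiffWithinAt ℝ ∞ (β.inChart (f x)) (range I')
          (writtenInExtChartAt I I' x f (extChartAt I x x)) := by
        rw [writtenInExtChartAt_apply_self]
        exact hβ
      exact hβ'.comp (extChartAt I x x) hg (mapsTo_writtenInExtChartAt_range f x)
    · exact hg.fderivWithin_right I.uniqueDiffOn (by simp) hc
  exact hsm.congr_of_eventuallyEq hev (hev.self_of_nhdsWithin hc)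

/-- **Naturality of `d`, pointwise** (Warner (1983), Prop. 2.23; Lee (2013), Prop. 14.26): if `f`
is `C^∞` near `x` and `β` is smooth at `f x`, then `d(f^*β) x = (f^*dβ) x`. In the chart at `x`
both sides are Mathlib's `extDerivWithin` of the pull-back of `β.inChart (f x)` along the written
map `g` (`MForm.inChart_pullback_eventuallyEq`, `extDerivWithin_pullback`), read through
`mfderiv I I' f x = Dg(extChartAt I x x)`. [cite: WarnerGTM94, Prop. 2.23] -/
theorem mextDeriv_pullback_apply {f : M → N} {β : MForm I' N F k} {x : M}
    (hf : ∀ᶠ z in 𝓝 x, ContMDiffAt I I' ∞ f z) (hβ : β.SmoothAt (f x)) :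
    mextDeriv (β.pullback I f) x = (mextDeriv β).pullback I f x := by
  have hfx : ContMDiffAt I I' ∞ f x := hf.self_of_nhds
  have hc : extChartAt I x x ∈ range I := mem_range_self _
  have hg : ContDiffWithinAt ℝ ∞ (writtenInExtChartAt I I' x f) (range I) (extChartAt I x x) :=
    (contMDiffAt_iff.1 hfx).2
  have hev := β.inChart_pullback_eventuallyEq (I := I) (I' := I')
    (hf.mono fun z hz ↦ hz.mdifferentiableAt (by simp))
  have hω : DifferentiableWithinAt ℝ (β.inChart (f x)) (range I')
      (writtenInExtChartAt I I' x f (extChartAt I x x)) := by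
    rw [writtenInExtChartAt_apply_self]
    exact hβ.differentiableWithinAt (by simp)
  have hr : minSmoothness ℝ 2 ≤ ∞ := by
    rw [minSmoothness_of_isRCLikeNormedField]
    exact WithTop.coe_le_coe.2 le_top
  rw [mextDeriv_eq_extDerivWithin, hev.extDerivWithin_eq (hev.self_of_nhdsWithin hc),
    extDerivWithin_pullback hω hg hr I.uniqueDiffOn (I.range_subset_closure_interior hc) hc
      (mapsTo_writtenInExtChartAt_range f x),
    writtenInExtChartAt_apply_self, ← (hfx.mdifferentiableAt (by simp)).mfderiv,
    ← mextDeriv_eq_extDerivWithin]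
  rfl

/-- Naturality of `d` near a point: if `f` is `C^∞` near `x` and `β` is smooth near `f x`, then
`d(f^*β) = f^*(dβ)` near `x`. [cite: WarnerGTM94, Prop. 2.23] -/
theorem mextDeriv_pullback_eventuallyEq {f : M → N} {β : MForm I' N F k} {x : M}
    (hf : ∀ᶠ z in 𝓝 x, ContMDiffAt I I' ∞ f z) (hβ : ∀ᶠ w in 𝓝 (f x), β.SmoothAt w) :
    ∀ᶠ z in 𝓝 x, mextDeriv (β.pullback I f) z = (mextDeriv β).pullback I f z := by
  have hfx : ContMDiffAt I I' ∞ f x := hf.self_of_nhds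
  filter_upwards [hf.eventually_nhds, hfx.continuousAt.eventually hβ] with z hz hz'
  exact mextDeriv_pullback_apply hz hz'

/-! ### Discharge of the named facts `IsSmoothFormPullback`, `MextDerivPullback` -/

variable (I M I' N F) in
/-- **Discharge of the named fact `IsSmoothFormPullback I M I' N F`** of
`Literature/NumberTheory/Transcendental/FormsAlgebra` (the pull-back of a smooth form along a
`C^∞` map is smooth, Warner (1983), 2.22), for every pair of `C^∞` manifolds and every coefficient
space. [cite: WarnerGTM94, 2.22] -/
theorem isSmoothFormPullback_holds :
    Literature.NumberTheory.Transcendental.IsSmoothFormPullback I M I' N F := by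
  intro k f hf β hβ x
  exact MForm.SmoothAt.pullback (Eventually.of_forall fun z ↦ hf z) (hβ (f x))

variable (I M I' N F) in
/-- **Discharge of the named fact `MextDerivPullback I M I' N F`** of
`Literature/NumberTheory/Transcendental/FormsAlgebra` (naturality of `d`: `d(f^*β) = f^*(dβ)` for
`C^∞` maps and smooth forms, Warner (1983), Prop. 2.23), for every pair of `C^∞` manifolds and
every coefficient space. [cite: WarnerGTM94, Prop. 2.23] -/
theorem mextDerivPullback_holds :
    Literature.NumberTheory.Transcendental.MextDerivPullback I M I' N F := by
  intro k f hf β hβ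
  funext x
  exact mextDeriv_pullback_apply (Eventually.of_forall fun z ↦ hf z) (hβ (f x))

/-- **The pull-back calculus is unconditional**: the instance hypothesis
`[PullbackFacts I M I' N F]` of `FormsAlgebra` (smoothness of `f^*β` and naturality of `d`) holds
for every pair of `C^∞` manifolds and every coefficient space, so that `deRhamCohomology.map`,
`complexDeRhamCohomology.map` and the naturality statements built on them need no hypothesis.
[cite: WarnerGTM94, 2.22–2.23] -/
instance instPullbackFacts : Literature.NumberTheory.Transcendental.PullbackFacts I M I' N F :=
  ⟨isSmoothFormPullback_holds I M I' N F, mextDerivPullback_holds I M I' N F⟩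

end Chart

/-! ### Restriction to an open submanifold -/

section Opens

variable {U : TopologicalSpace.Opens M}

/-- **The inclusion of an open submanifold has identity differential** (Lee (2013), Example 1.26,
Prop. 3.9: `T_p U = T_p M`). This verbatim copy is superseded by the Mathlib-only canonical home
`Literature.Geometry.Manifold.OpenSubmanifold.hasMFDerivAt_subtype_val`
(`OpenSubmanifoldMFDeriv.lean`, promote event 131699) and kept under its old name as a deprecated
alias. [folklore] -/
@[deprecated Literature.Geometry.Manifold.OpenSubmanifold.hasMFDerivAt_subtype_val
  (since := "2026-08-15")]
theorem hasMFDerivAt_subtype_val (x : U) :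
    HasMFDerivAt I I (Subtype.val : U → M) x (ContinuousLinearMap.id ℝ E) :=
  Literature.Geometry.Manifold.OpenSubmanifold.hasMFDerivAt_subtype_val x

/-- The differential of the inclusion of an open submanifold is the identity: deprecated alias of
`Literature.Geometry.Manifold.OpenSubmanifold.mfderiv_subtype_val` (promote event 131699).
[folklore] -/
@[deprecated Literature.Geometry.Manifold.OpenSubmanifold.mfderiv_subtype_val
  (since := "2026-08-15")]
theorem mfderiv_subtype_val (x : U) :
    mfderiv I I (Subtype.val : U → M) x = ContinuousLinearMap.id ℝ E :=
  Literature.Geometry.Manifold.OpenSubmanifold.mfderiv_subtype_val x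

/-- **Restriction of a form to an open submanifold**: the pull-back of `β` along the inclusion
`U → M` is `β` itself read on `U` (`T_x U = T_x M`), `(β|_U) x v = β x v`. [folklore] -/
@[simp]
theorem MForm.pullback_subtypeVal_apply (β : MForm I M F k) (x : U)
    (v : Fin k → TangentSpace I x) :
    β.pullback I (Subtype.val : U → M) x v = β (x : M) v := by
  simp only [MForm.pullback_apply, Literature.Geometry.Manifold.OpenSubmanifold.mfderiv_subtype_val]
  rfl

variable [IsManifold I ∞ M]

/-- The restriction to an open submanifold of a form smooth at a point of it is smooth there
(Warner (1983), 2.22, for the `C^∞` inclusion `U → M`). [cite: WarnerGTM94, 2.22] -/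
theorem MForm.SmoothAt.pullback_subtypeVal {β : MForm I M F k} {x : U} (hβ : β.SmoothAt (x : M)) :
    (β.pullback I (Subtype.val : U → M)).SmoothAt x :=
  MForm.SmoothAt.pullback (Eventually.of_forall fun z ↦ contMDiff_subtype_val z) hβ

/-- **`d` commutes with restriction to an open submanifold**, at every point of `U` at which the
form is smooth: `d(β|_U) x v = (dβ) x v` (Warner (1983), Prop. 2.23, for the inclusion `U → M`,
whose differential is the identity). [cite: WarnerGTM94, Prop. 2.23] -/
theorem mextDeriv_pullback_subtypeVal_apply {β : MForm I M F k} {x : U} (hβ : β.SmoothAt (x : M))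
    (v : Fin (k + 1) → TangentSpace I x) :
    mextDeriv (β.pullback I (Subtype.val : U → M)) x v = mextDeriv β (x : M) v := by
  rw [mextDeriv_pullback_apply (Eventually.of_forall fun z ↦ contMDiff_subtype_val z) hβ,
    MForm.pullback_subtypeVal_apply]

/-- The restriction to an open submanifold of a smooth form is smooth. [cite: WarnerGTM94, 2.22] -/
theorem IsSmoothForm.pullback_subtypeVal {β : MForm I M F k} (hβ : IsSmoothForm β) :
    IsSmoothForm (β.pullback I (Subtype.val : U → M)) := fun x ↦
  MForm.SmoothAt.pullback_subtypeVal (hβ (x : M))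

end Opens

end Literature.Geometry.Kaehler
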